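import Mathlib
import Summits.KontsevichZagierPeriods.Zeta5Search.BrickPhiFour
import Summits.KontsevichZagierPeriods.Zeta5Search.AperyOffDigitBinomials

/-!
# BrickTopCoefficient — the leading Laurent coefficient of the brick kernel at a digit pole:
`lim_{t→−j}(t+j)^A·R_n^{(A,B,ε)}(t) = (−1)^{nB+jA}(n/2 − j)^ε·C(n,j)^A·[C(n+j,j)·C(2n−j,n)]^B` (cell zeta5-irr)

HONEST FRAMING: systematic search; no irrationality claim unless certified. INSTRUMENT lemma of the ζ(5)
census cell zeta5-irr (HOME `run/shared/lean/pub/zeta5-irr/`; memo `zi-p2/LEMMAS.md` §B8-a″ THEOREM 5, SETTING: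
«leading coefficient c_{j,A}(n) = (−1)^{nB}(n/2 − j)C(n,j)^A[C(n+j,j)C(2n−j,n)]^B» of the kernel
`R_n(t) = n!^{A−2B}(t+n/2)(t−n)_n^B(t+n+1)_n^B/(t)_{n+1}^A`, the `c_{j,A}` of the exact identity (F4)
`Σ_j q_n(j)c_{j,A}(n) = 0`, HOME `zi-p2/SketchT5.lean`). Nothing here is about ζ(5); no irrationality content;
filing moves no rung. Filed by the engine seat zi-eng (g7).

## The statement

For the tree's brick kernel `brickKernel A B ε n t = n!^{A−2B}(t+n/2)^ε∏_{m=1}^{n}(t−m)^B∏_{m=1}^{n}(t+n+m)^B /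
∏_{m=0}^{n}(t+m)^A` (`BrickKernelFrobenius`) and a digit index `0 ≤ j ≤ n`, the pole of order `A` at `t = −j` has
REGULAR PART `g_j(t) = n!^{A−2B}(t+n/2)^ε∏(t−m)^B∏(t+n+m)^B/∏_{m≤n, m≠j}(t+m)^A` (`topFun`):
`R_n(t)·(t+j)^A = g_j(t)` for `t ≠ −j` (`brickKernel_mul_pow`), and its value at the pole — the leading Laurent
coefficient `c_{j,A}(n)` — is, by `∏_{m=1}^{n}(−j−m) = (−1)ⁿ(n+j)!/j!`, `∏_{m=1}^{n}(n−j+m) = (2n−j)!/(n−j)!`,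
`∏_{m≤n, m≠j}(m−j) = (−1)^j·j!·(n−j)!`:

**`g_j(−j) = (−1)^{nB+jA}·(n/2 − j)^ε·C(n,j)^A·[C(n+j,j)·C(2n−j,n)]^B`** (`topFun_neg_natCast`, `cTop`).

For `A` even and `ε = 1` this is zi-p2's `c_{j,A}(n)` (`ZiP2.B8.T5.cTop`; `cTop_of_even`), which is ANTISYMMETRIC
under `j ↦ n−j` (`cTop_reflect`); with the reflection-INVARIANT cubic `q_n(j)` (`BrickPhiFour.qBall_…`) this gives
the exact identity **(F4) `Σ_{j=0}^{n} q_n(j)·c_{j,A}(n) = 0`** (`sum_qBall_mul_cTop`; the proof is zi-p2's, HOME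
`zi-p2/SketchT5.lean` `qMomentVanishes_holds`, here over the tree's `qBall`).
-/

namespace Summit.KontsevichZagierPeriods.Zeta5Search.BrickTopCoefficient

open Finset Nat
open Summit.KontsevichZagierPeriods.Zeta5Search.BrickKernelFrobenius (brickKernel)
open Summit.KontsevichZagierPeriods.Zeta5Search.BrickPhiFour (S2 qBall)
open Summit.KontsevichZagierPeriods.Zeta5Search.OffDigitBinomials (factorial_add_eq_mul_prod factorial_sub_mul_prod)

section kernel

variable {K : Type*} [Field K]

/-- The regular part of the brick kernel at the pole `−j`:
`g_j(t) = n!^{A−2B}(t+n/2)^ε∏_{m=1}^{n}(t−m)^B∏_{m=1}^{n}(t+n+m)^B / ∏_{m≤n, m≠j}(t+m)^A`. -/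
def topFun (A B ε n j : ℕ) (t : K) : K :=
  (n ! : K) ^ (A - 2 * B) * (t + (n : K) / 2) ^ ε * (∏ m ∈ Icc 1 n, (t - m)) ^ B *
      (∏ m ∈ Icc 1 n, (t + n + m)) ^ B / (∏ m ∈ (range (n + 1)).erase j, (t + m)) ^ A

/-- **`R_n(t)·(t+j)^A = g_j(t)` off the pole**: for `j ≤ n` and `t + j ≠ 0` (other poles included: both sides are
`x/0 = 0` there). -/
theorem brickKernel_mul_pow (A B ε : ℕ) {n j : ℕ} (hj : j ≤ n) {t : K} (ht : t + j ≠ 0) :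
    brickKernel A B ε n t * (t + j) ^ A = topFun A B ε n j t := by
  unfold brickKernel topFun
  have hmem : j ∈ range (n + 1) := mem_range.2 (by omega)
  rw [← Finset.mul_prod_erase (range (n + 1)) (fun m => t + (m : K)) hmem, mul_pow, div_mul_eq_mul_div,
    mul_comm ((t + (j : K)) ^ A) _, mul_div_mul_right _ _ (pow_ne_zero A ht)]

end kernel

/-- **The leading coefficient in closed form**: `c = (−1)^{nB+jA}·(n/2 − j)^ε·C(n,j)^A·[C(n+j,j)·C(2n−j,n)]^B`. -/
def cTop (A B ε n j : ℕ) : ℚ :=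
  (-1) ^ (n * B + j * A) * ((n : ℚ) / 2 - j) ^ ε * (n.choose j : ℚ) ^ A *
    (((n + j).choose j : ℚ) * ((2 * n - j).choose n : ℚ)) ^ B

/-- `∏_{m=1}^{n}(−j − m) = (−1)ⁿ·(n+j)!/j!`. -/
theorem prod_neg_sub_eq (n j : ℕ) :
    ∏ m ∈ Icc 1 n, (-(j : ℚ) - m) = (-1) ^ n * (((n + j)! : ℕ) : ℚ) / ((j ! : ℕ) : ℚ) := by
  have hj : ((j ! : ℕ) : ℚ) ≠ 0 := by positivity
  rw [eq_div_iff hj]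
  have h := congrArg (fun x : ℕ => (x : ℚ)) (factorial_add_eq_mul_prod j n)
  simp only [Nat.cast_mul, Nat.cast_prod] at h
  rw [show n + j = j + n by ring, h, show (∏ m ∈ Icc 1 n, (-(j : ℚ) - m)) = ∏ m ∈ Icc 1 n, ((-1) * ((j + m : ℕ) : ℚ))
    from Finset.prod_congr rfl fun m _ => by push_cast; ring, Finset.prod_mul_distrib, Finset.prod_const,
    Nat.card_Icc, Nat.add_sub_cancel]
  ring

/-- `∏_{m=1}^{n}(−j + n + m) = (2n−j)!/(n−j)!` for `j ≤ n`. -/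
theorem prod_neg_add_eq {n j : ℕ} (hj : j ≤ n) :
    ∏ m ∈ Icc 1 n, (-(j : ℚ) + n + m) = (((2 * n - j)! : ℕ) : ℚ) / (((n - j)! : ℕ) : ℚ) := by
  have hnj : (((n - j)! : ℕ) : ℚ) ≠ 0 := by positivity
  rw [eq_div_iff hnj]
  have h := congrArg (fun x : ℕ => (x : ℚ)) (factorial_add_eq_mul_prod (n - j) n)
  simp only [Nat.cast_mul, Nat.cast_prod] at h
  rw [show 2 * n - j = n - j + n by omega, h, mul_comm]
  congr 1
  exact Finset.prod_congr rfl fun m _ => by push_cast [Nat.cast_sub hj]; ring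

/-- `∏_{m ≤ n, m ≠ j}(−j + m) = (−1)^j·j!·(n−j)!` for `j ≤ n` (the factors `m < j` give `(−1)^j j!`, the factors
`j < m ≤ n` give `(n−j)!`). -/
theorem prod_erase_neg_add_eq {n j : ℕ} (hj : j ≤ n) :
    ∏ m ∈ (range (n + 1)).erase j, (-(j : ℚ) + m) = (-1) ^ j * ((j ! : ℕ) : ℚ) * (((n - j)! : ℕ) : ℚ) := by
  have hsplit : (range (n + 1)).erase j = range j ∪ Ico (j + 1) (n + 1) := by
    ext m; simp only [mem_erase, mem_range, mem_union, mem_Ico]; omega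
  have hdisj : Disjoint (range j) (Ico (j + 1) (n + 1)) := by
    rw [Finset.disjoint_left]; intro m hm hm'; rw [mem_range] at hm; rw [mem_Ico] at hm'; omega
  rw [hsplit, Finset.prod_union hdisj]
  -- the factors below the pole
  have h1 : ∏ m ∈ range j, (-(j : ℚ) + m) = (-1) ^ j * ((j ! : ℕ) : ℚ) := by
    have h := congrArg (fun x : ℕ => (x : ℚ)) (factorial_sub_mul_prod j j le_rfl)
    simp only [Nat.sub_self, Nat.factorial_zero, one_mul, Nat.cast_prod] at h
    rw [← h, show (∏ m ∈ range j, (-(j : ℚ) + m)) = ∏ m ∈ range j, ((-1) * ((j - m : ℕ) : ℚ)) from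
      Finset.prod_congr rfl fun m hm => by rw [mem_range] at hm; push_cast [Nat.cast_sub hm.le]; ring,
      Finset.prod_mul_distrib, Finset.prod_const, Finset.card_range]
  -- the factors above the pole
  have h2 : ∏ m ∈ Ico (j + 1) (n + 1), (-(j : ℚ) + m) = (((n - j)! : ℕ) : ℚ) := by
    rw [← Finset.prod_Ico_id_eq_factorial, Nat.cast_prod, show j + 1 = 1 + j by ring,
      show n + 1 = (n - j + 1) + j by omega, ← Finset.prod_Ico_add' (fun m : ℕ => (-(j : ℚ) + (m : ℚ))) 1 (n - j + 1) j]
    exact Finset.prod_congr rfl fun m _ => by push_cast; ring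
  rw [h1, h2]

/-- **The leading Laurent coefficient of the brick kernel at `−j`**: for `j ≤ n`,
`g_j(−j) = (−1)^{nB+jA}·(n/2 − j)^ε·C(n,j)^A·[C(n+j,j)·C(2n−j,n)]^B = cTop A B ε n j`. -/
theorem topFun_neg_natCast {A B : ℕ} (hAB : 2 * B ≤ A) (ε : ℕ) {n j : ℕ} (hj : j ≤ n) :
    topFun A B ε n j (-(j : ℚ)) = cTop A B ε n j := by
  obtain ⟨a, rfl⟩ : ∃ a, A = a + 2 * B := ⟨A - 2 * B, by omega⟩
  unfold topFun cTop
  rw [Nat.add_sub_cancel, prod_neg_sub_eq, prod_neg_add_eq hj, prod_erase_neg_add_eq hj,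
    Nat.cast_choose ℚ hj, Nat.cast_choose ℚ (Nat.le_add_left j n), Nat.cast_choose ℚ (by omega : n ≤ 2 * n - j),
    show n + j - j = n by omega, show 2 * n - j - n = n - j by omega]
  have hj0 : ((j ! : ℕ) : ℚ) ≠ 0 := by positivity
  have hn0 : ((n ! : ℕ) : ℚ) ≠ 0 := by positivity
  have hnj0 : (((n - j)! : ℕ) : ℚ) ≠ 0 := by positivity
  simp only [div_pow, mul_pow, ← pow_mul]
  have hσ : ((-1 : ℚ) ^ (j * (a + 2 * B)))⁻¹ = (-1 : ℚ) ^ (j * (a + 2 * B)) := by rw [← inv_pow, inv_neg_one]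
  rw [div_eq_mul_inv, mul_inv, mul_inv, hσ, pow_add]
  field_simp
  ring

/-- **The leading Laurent coefficient of the tree's brick kernel**: for `2B ≤ A`, `j ≤ n` and `t ≠ −j`,
`brickKernel A B ε n t · (t+j)^A = g_j(t)` with `g_j(−j) = cTop A B ε n j` — packaged. -/
theorem brickKernel_mul_pow_and_top {A B : ℕ} (hAB : 2 * B ≤ A) (ε : ℕ) {n j : ℕ} (hj : j ≤ n) :
    (∀ t : ℚ, t + j ≠ 0 → brickKernel A B ε n t * (t + j) ^ A = topFun A B ε n j t) ∧
      topFun A B ε n j (-(j : ℚ)) = cTop A B ε n j :=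
  ⟨fun _ ht => brickKernel_mul_pow A B ε hj ht, topFun_neg_natCast hAB ε hj⟩

/-! ## Reflection and the exact identity (F4) (zi-p2, HOME `zi-p2/SketchT5.lean`) -/

/-- For EVEN `A` and `ε = 1` the closed form is zi-p2's `c_{j,A}(n) = (−1)^{nB}(n/2 − j)C(n,j)^A[C(n+j,j)C(2n−j,n)]^B`
(`ZiP2.B8.T5.cTop`: the sign `(−1)^{jA}` is `+1`). -/
theorem cTop_of_even {A : ℕ} (hA : Even A) (B n j : ℕ) :
    cTop A B 1 n j = (-1 : ℚ) ^ (n * B) * ((n : ℚ) / 2 - j) * (n.choose j : ℚ) ^ A *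
      (((n + j).choose j : ℚ) * ((2 * n - j).choose n : ℚ)) ^ B := by
  unfold cTop
  rw [pow_add, (hA.mul_left j).neg_one_pow, mul_one, pow_one]

/-- Reflection ANTI-invariance (zi-p2's `cTop_reflect`): `c_{n−j,A}(n) = −c_{j,A}(n)` for even `A`, `ε = 1`, `j ≤ n`. -/
theorem cTop_reflect {A : ℕ} (hA : Even A) (B : ℕ) {n j : ℕ} (hj : j ≤ n) :
    cTop A B 1 n (n - j) = -cTop A B 1 n j := by
  rw [cTop_of_even hA, cTop_of_even hA]
  have h1 : n.choose (n - j) = n.choose j := Nat.choose_symm hj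
  have h2 : (n + (n - j)).choose (n - j) = (2 * n - j).choose n := by
    rw [show n + (n - j) = 2 * n - j by omega, ← Nat.choose_symm (show n - j ≤ 2 * n - j by omega)]
    congr 1; omega
  have h3 : (2 * n - (n - j)).choose n = (n + j).choose j := by
    rw [show 2 * n - (n - j) = n + j by omega, ← Nat.choose_symm (show j ≤ n + j by omega)]
    congr 1; omega
  rw [h1, h2, h3]
  push_cast [Nat.cast_sub hj]
  ring

/-- Reflection INVARIANCE of LEMMA Φ4's cubic (zi-p2's `qBall_reflect`): `q_n(n−j) = q_n(j)` for `j ≤ n`. -/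
theorem qBall_reflect (A B : ℕ) {n j : ℕ} (hj : j ≤ n) : qBall A B n (n - j) = qBall A B n j := by
  unfold qBall
  rw [show n - (n - j) = j by omega, show 2 * n - (n - j) - 1 = j + n - 1 by omega,
    show n - j + n - 1 = 2 * n - j - 1 by omega]
  ring

/-- **(F4)** (zi-p2 THEOREM 5 Step F, `ZiP2.B8.T5.qMomentVanishes_holds`; here over the tree's `qBall` and the
`cTop` identified above with the brick kernel's leading coefficient): for even `A`, every `B`, `n`:
`Σ_{j=0}^{n} q_n(j)·c_{j,A}(n) = 0` (reflection `j ↦ n−j`: `q` invariant, `c` anti-invariant). -/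
theorem sum_qBall_mul_cTop {A : ℕ} (hA : Even A) (B n : ℕ) :
    ∑ j ∈ range (n + 1), (qBall A B n j : ℚ) * cTop A B 1 n j = 0 := by
  set f : ℕ → ℚ := fun j => (qBall A B n j : ℚ) * cTop A B 1 n j with hf
  have hrefl : ∑ j ∈ range (n + 1), f (n + 1 - 1 - j) = ∑ j ∈ range (n + 1), f j :=
    Finset.sum_range_reflect f (n + 1)
  have hneg : ∑ j ∈ range (n + 1), f (n + 1 - 1 - j) = -∑ j ∈ range (n + 1), f j := by
    rw [← Finset.sum_neg_distrib]
    refine Finset.sum_congr rfl fun j hj => ?_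
    have hjn : j ≤ n := by have := Finset.mem_range.mp hj; omega
    rw [show n + 1 - 1 - j = n - j by omega, hf]
    simp only
    rw [qBall_reflect A B hjn, cTop_reflect hA B hjn]
    ring
  have h : ∑ j ∈ range (n + 1), f j = 0 := by linarith
  simpa [hf] using h

/-- sanity (`ZiP2.B8.T5`'s example): `(A,B) = (6,1)`, `n = 1`, `j = 0`: `c = (−1)·(1/2)·1·2 = −1`. -/
example : cTop 6 1 1 1 0 = -1 := by
  unfold cTop; norm_num [Nat.choose]

end Summit.KontsevichZagierPeriods.Zeta5Search.BrickTopCoefficient
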